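import Literature.Computability.Cryptography.ClassBQP
import Literature.Computability.Cryptography.QuantumCircuitDescFP
import Literature.Computability.Complexity.ListBricks
import Literature.Computability.Complexity.FoldBricks
import HarnessLib

/-!
# Transport of quantum circuit families along an embedding of gate sets

Topic `Literature/Computability/Cryptography`; infrastructure for comparing the tree's circuit
classes over different gate sets (`BQPWith G ε`, `BQPOver G`, `PromiseBQPOver G`): the
elementary half of gate-set independence — **enlarging the gate set does not shrink the class**
("any gate set containing a universal set is at least as powerful"; Bernstein–Vazirani 1997, §8;
Nielsen–Chuang 2010, §4.5; Watrous 2009, §III.1, where the classes are noted to be robust under the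
choice of a finite universal gate set, the inclusion in this direction being by relabelling the
gates). In the tree's model a family over `G` becomes a family over `G'` along a map of gate
symbols `ι : G.Op → G'.Op` preserving arities and matrices (`GateSetEmb`); its semantics is
unchanged (`toMatrix_mapCircuit`, `acceptProbOn_mapFamily`, `kernel_mapFamily`), and — the only
point needing work — **polynomial-time uniformity is preserved** (`isUniform_mapFamily`): the
description `sigmaEncode ⟨n, m, C⟩ = ⟨bin n, ⟨1^m, [gate codes]⟩⟩` of the transported circuit is
obtained from that of `C` by rewriting, inside every gate code `0 ⟨bin (code g), wires⟩`, the
numeral `bin (code g)` into `bin (code (ι g))`; when this rewriting of numerals is a polynomial-time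
string function of linear growth (field `codeFn`, e.g. `c ↦ 2c` for a left summand `Sum.inl`,
`c ↦ 2c + 1` for a right summand, `GateSetEmb.ofDouble`, `GateSetEmb.ofDoubleAddOne`), the whole
rewriting is an `FP` string transducer (`descMapFn`, assembled from the tree's bricks: `mapLF` over
the coded gate list, `iteFn` on the tag bit, `fstF`/`sndF`), and `FP` is closed under composition.
Consequence at the class level: `GateSetEmb.BQPWith_subset` (`BQPWith G ε ⊆ BQPWith G' ε`); the
promise-class statement `PromiseBQPOver G ⊆ PromiseBQPOver G'` (for `PromiseBQPOver` of
`QuantumComplexity/JonesInBQPProofs.lean`, intended consumer: the named fact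
`ajl_mem_PromiseBQPOver_ajlGateSet` there) is left to a follow-up file importing both.

Relation to `QuantumComplexity/BQPGateSetIndependence.lean`: its `GateCompiler G₁ G₂` compiles each
gate APPROXIMATELY into a word over the target set (the Solovay–Kitaev direction) and does not treat
uniformity; here the embedding is exact (a relabelling), and the content is the uniformity transfer.

## References

* E. Bernstein, U. Vazirani, *Quantum complexity theory*, SIAM J. Comput. 26 (1997), §8
  [BernsteinVazirani1997].
* M. A. Nielsen, I. L. Chuang, *Quantum Computation and Quantum Information*, CUP 2010, §4.5.2–4.5.3
  [NielsenChuang2010].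
* S. Arora, B. Barak, *Computational Complexity: A Modern Approach*, CUP 2009, §1.3 (closure of
  polynomial time under composition), §6.2 (descriptions of circuit families) [AroraBarak2009].

## Design notes

* The arity condition is an equation `G'.arity (ι g) = G.arity g` and the matrix condition a `HEq`;
  placements are transported by `Eq.rec` (`castEmb`), which computes to the identity when the arity
  equation holds by `rfl` (the case of summands of a sum alphabet).
* The code transducer is a field (not derived from `ι`) so that one structure covers `Sum.inl`
  (`bin c ↦ bin 2c`: prepend `0` unless empty), `Sum.inr` (`bin c ↦ bin (2c+1)`: prepend `1`) and any
  other polynomial-time recoding of linear growth.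
-/

noncomputable section

namespace Literature.Computability.Cryptography

open _root_.Computability Complexity Complexity.Brick Matrix

/-! ### Binary numerals: doubling -/

/-- `2m + 1` in binary is `1` followed by the code of `m` (least significant bit first); the even
case is the tree's `Com.encodeNat_two_mul` (`StackIntsMul.lean`). [folklore] -/
theorem encodeNat_two_mul_add_one (m : ℕ) : encodeNat (2 * m + 1) = true :: encodeNat m := by
  change encodeNum (Num.ofNat' (2 * m + 1)) = true :: encodeNum (Num.ofNat' m)
  rw [← Nat.bit_true_apply, Num.ofNat'_bit]
  cases h : Num.ofNat' m with
  | zero => simp [encodeNum, Num.bit1, encodePosNum]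
  | pos p => simp [encodeNum, Num.bit1, encodePosNum]

/-- **Doubling on numerals**: `bin c ↦ bin 2c`, i.e. prepend `0` unless the numeral is empty.
[cite: AroraBarak2009, §0.1 (binary representation)] -/
def dblNumFn (m : List Bool) : List Bool := if m = [] then [] else false :: m

/-- `dblNumFn (bin c) = bin (2c)`. [folklore] -/
theorem dblNumFn_encodeNat (c : ℕ) : dblNumFn (encodeNat c) = encodeNat (2 * c) := by
  by_cases hc : c = 0
  · subst hc; rfl
  · rw [Com.encodeNat_two_mul c (Nat.pos_of_ne_zero hc), dblNumFn, if_neg (fun h => hc ((encodeNat_eq_nil_iff c).1 h))]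

/-- `dblNumFn` as a brick: branch on emptiness, else prepend `0`. [folklore] -/
theorem dblNumFn_eq : dblNumFn = iteFn isNilFn (fun _ => []) (List.cons false) := by
  funext m
  rw [iteFn_of_oneBit oneBit_isNilFn]
  by_cases hm : m = [] <;> simp [dblNumFn, isNilFn, hm]

/-- `dblNumFn ∈ FP`. [cite: AroraBarak2009, §1.3] -/
theorem dblNumFn_mem_FP : dblNumFn ∈ FP := by
  rw [dblNumFn_eq]; exact iteFn_mem_FP isNilFn_mem_FP (const_mem_FP _) (cons_mem_FP false)

/-- `dblNumFn` adds at most one symbol. [folklore] -/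
theorem length_dblNumFn_le (m : List Bool) : (dblNumFn m).length ≤ m.length + 1 := by
  by_cases hm : m = [] <;> simp [dblNumFn, hm]

/-- `bin c ↦ bin (2c + 1)` is `List.cons true`. [folklore] -/
theorem cons_true_encodeNat (c : ℕ) : true :: encodeNat c = encodeNat (2 * c + 1) :=
  (encodeNat_two_mul_add_one c).symm

/-! ### Embeddings of gate sets -/

/-- **An embedding of gate sets** `G ↪ G'` for the purpose of transporting uniform circuit
families: a map of gate symbols preserving arities and matrices, together with a polynomial-time
string function `codeFn` of linear growth rewriting the binary numeral of the code of a symbol into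
that of its image (the only datum of a gate's description that changes).
[cite: BernsteinVazirani1997, §8] [cite: AroraBarak2009, §6.2 (descriptions of circuits)] -/
structure GateSetEmb (G G' : QGateSet) [Encodable G.Op] [Encodable G'.Op] where
  /-- the map of gate symbols -/
  ι : G.Op → G'.Op
  /-- arities are preserved -/
  arity_eq : ∀ g, G'.arity (ι g) = G.arity g
  /-- matrices are preserved (heterogeneously, along `arity_eq`) -/
  mat_heq : ∀ g, HEq (G'.mat (ι g)) (G.mat g)
  /-- the recoding of symbol numerals -/
  codeFn : List Bool → List Bool
  /-- `codeFn (bin (code g)) = bin (code (ι g))` -/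
  codeFn_encode : ∀ g, codeFn (encodeNat (Encodable.encode g)) = encodeNat (Encodable.encode (ι g))
  /-- the recoding is polynomial time -/
  codeFn_mem_FP : codeFn ∈ FP
  /-- growth allowance of the recoding -/
  slack : ℕ
  /-- the recoding has linear growth -/
  length_codeFn_le : ∀ m, (codeFn m).length ≤ m.length + slack

namespace GateSetEmb

variable {G G' : QGateSet} [Encodable G.Op] [Encodable G'.Op]

/-- **Embedding onto symbols of doubled code** (`code (ι g) = 2 · code g`, e.g. `ι = Sum.inl` for a
sum alphabet with Mathlib's `Encodable` instance): the recoding is `dblNumFn`.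
[cite: AroraBarak2009, §0.1 (binary representation)] -/
def ofDouble (ι : G.Op → G'.Op) (harity : ∀ g, G'.arity (ι g) = G.arity g) (hmat : ∀ g, HEq (G'.mat (ι g)) (G.mat g))
    (hcode : ∀ g, Encodable.encode (ι g) = 2 * Encodable.encode g) : GateSetEmb G G' where
  ι := ι
  arity_eq := harity
  mat_heq := hmat
  codeFn := dblNumFn
  codeFn_encode g := by rw [hcode, dblNumFn_encodeNat]
  codeFn_mem_FP := dblNumFn_mem_FP
  slack := 1
  length_codeFn_le := length_dblNumFn_le

/-- **Embedding onto symbols of code `2 · code g + 1`** (e.g. `ι = Sum.inr`): the recoding prepends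
`1`. [cite: AroraBarak2009, §0.1 (binary representation)] -/
def ofDoubleAddOne (ι : G.Op → G'.Op) (harity : ∀ g, G'.arity (ι g) = G.arity g)
    (hmat : ∀ g, HEq (G'.mat (ι g)) (G.mat g)) (hcode : ∀ g, Encodable.encode (ι g) = 2 * Encodable.encode g + 1) :
    GateSetEmb G G' where
  ι := ι
  arity_eq := harity
  mat_heq := hmat
  codeFn := List.cons true
  codeFn_encode g := by rw [hcode, cons_true_encodeNat]
  codeFn_mem_FP := cons_mem_FP true
  slack := 1
  length_codeFn_le m := by simp

/-! ### Transport of gates, circuits, families -/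

/-- A placement transported along an equation of arities. [folklore] -/
def castEmb {k k' n : ℕ} (h : k' = k) (e : Fin k ↪ Fin n) : Fin k' ↪ Fin n := h ▸ e

/-- The wire list of a transported placement is unchanged. [folklore] -/
theorem ofFn_castEmb {k k' n : ℕ} (h : k' = k) (e : Fin k ↪ Fin n) :
    (List.ofFn fun i => ((castEmb h e) i : ℕ)) = List.ofFn fun i => (e i : ℕ) := by
  subst h; rfl

/-- Placing heterogeneously equal matrices along a transported placement gives the same operator.
[folklore] -/
theorem placeGate_castEmb {R : Type*} [CommRing R] {k k' n : ℕ} (h : k' = k) (e : Fin k ↪ Fin n)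
    {M' : Matrix (QReg k') (QReg k') R} {M : Matrix (QReg k) (QReg k) R} (hM : HEq M' M) :
    placeGate (castEmb h e) M' = placeGate e M := by
  subst h; cases hM; rfl

variable (E : GateSetEmb G G') {n : ℕ}

/-- **Transport of a placed gate**: relabel the symbol, keep the wires; oracle gates unchanged.
[cite: BernsteinVazirani1997, §8] -/
def mapGate : QGate G n → QGate G' n
  | .gate g e => .gate (E.ι g) (castEmb (E.arity_eq g) e)
  | .oracle k e => .oracle k e

/-- **Transport of a circuit**, gate by gate. [cite: BernsteinVazirani1997, §8] -/
def mapCircuit (C : QCircuit G n) : QCircuit G' n := ⟨C.gates.map E.mapGate⟩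

/-- **Transport of a circuit family** (same ancilla counts). [cite: BernsteinVazirani1997, §8] -/
def mapFamily (F : QCircuitFamily G) : QCircuitFamily G' where
  ancillas := F.ancillas
  circ n := E.mapCircuit (F.circ n)

/-- The gate list of a transported circuit. [folklore] -/
@[simp] theorem gates_mapCircuit (C : QCircuit G n) : (E.mapCircuit C).gates = C.gates.map E.mapGate := rfl

/-- The ancilla count of a transported family. [folklore] -/
@[simp] theorem ancillas_mapFamily (F : QCircuitFamily G) (m : ℕ) : (E.mapFamily F).ancillas m = F.ancillas m := rfl

/-- The circuits of a transported family. [folklore] -/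
@[simp] theorem circ_mapFamily (F : QCircuitFamily G) (m : ℕ) : (E.mapFamily F).circ m = E.mapCircuit (F.circ m) := rfl

/-! ### Semantics is preserved -/

/-- A transported gate has the same matrix (for every oracle). [cite: BernsteinVazirani1997, §8] -/
theorem toMatrix_mapGate (A : Language Bool) (g : QGate G n) : (E.mapGate g).toMatrix A = g.toMatrix A := by
  cases g with
  | gate g e => exact placeGate_castEmb (E.arity_eq g) e (E.mat_heq g)
  | oracle k e => rfl

/-- **A transported circuit computes the same operator.** [cite: BernsteinVazirani1997, §8] -/
theorem toMatrix_mapCircuit (A : Language Bool) (C : QCircuit G n) : (E.mapCircuit C).toMatrix A = C.toMatrix A := by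
  obtain ⟨gs⟩ := C
  induction gs with
  | nil => rfl
  | cons g gs ih =>
    have h := QCircuit.toMatrix_cons A (E.mapGate g) (gs.map E.mapGate)
    rw [mapCircuit, List.map_cons, h, QCircuit.toMatrix_cons, toMatrix_mapGate]
    exact congrArg (· * g.toMatrix A) ih

/-- Transport preserves oracle-freeness of gates. [folklore] -/
theorem isOracleFree_mapGate {g : QGate G n} (h : g.IsOracleFree) : (E.mapGate g).IsOracleFree := by
  cases g with
  | gate g e => trivial
  | oracle k e => exact h

/-- Transport preserves oracle-freeness of circuits. [folklore] -/
theorem isOracleFree_mapCircuit {C : QCircuit G n} (h : C.IsOracleFree) : (E.mapCircuit C).IsOracleFree := by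
  intro g hg
  rw [gates_mapCircuit, List.mem_map] at hg
  obtain ⟨g₀, hg₀, rfl⟩ := hg
  exact E.isOracleFree_mapGate (h g₀ hg₀)

/-- **Transport preserves oracle-freeness of families.** [cite: BernsteinVazirani1997, §8] -/
theorem isOracleFree_mapFamily {F : QCircuitFamily G} (h : F.IsOracleFree) : (E.mapFamily F).IsOracleFree :=
  fun m => E.isOracleFree_mapCircuit (h m)

/-- Transport preserves the output state. [folklore] -/
theorem runOn_mapCircuit (A : Language Bool) (C : QCircuit G n) (ψ : QReg n → ℂ) :
    (E.mapCircuit C).runOn A ψ = C.runOn A ψ := by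
  rw [QCircuit.runOn, QCircuit.runOn, toMatrix_mapCircuit]

/-- Transport preserves acceptance probabilities of circuits. [folklore] -/
theorem acceptProb_mapCircuit (A : Language Bool) {m : ℕ} (C : QCircuit G (n + m)) (x : QReg n) :
    (E.mapCircuit C).acceptProb A x = C.acceptProb A x := by
  simp only [QCircuit.acceptProb, runOn_mapCircuit]

/-- Transport preserves output distributions of circuits. [folklore] -/
theorem outputPMF_mapCircuit (A : Language Bool) {m : ℕ} (C : QCircuit G (n + m)) (x : QReg n) :
    (E.mapCircuit C).outputPMF A x = C.outputPMF A x := by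
  rw [QCircuit.outputPMF, QCircuit.outputPMF, runOn_mapCircuit]

/-- **Transport preserves the acceptance probabilities of a family.** [cite: BernsteinVazirani1997, §8] -/
theorem acceptProbOn_mapFamily (A : Language Bool) (F : QCircuitFamily G) (x : List Bool) :
    (E.mapFamily F).acceptProbOn A x = F.acceptProbOn A x :=
  E.acceptProb_mapCircuit A (F.circ x.length) x.get

/-- **Transport preserves the input/output kernel of a family.** [cite: BernsteinVazirani1997, §8] -/
theorem kernel_mapFamily (A : Language Bool) (F : QCircuitFamily G) : (E.mapFamily F).kernel A = F.kernel A := by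
  funext x
  change (((E.mapCircuit (F.circ x.length)).outputPMF A x.get).map List.ofFn) = ((F.circ x.length).outputPMF A x.get).map List.ofFn
  rw [outputPMF_mapCircuit]

/-- Transport preserves kernel probabilities. [folklore] -/
theorem kernelProb_mapFamily (A : Language Bool) (F : QCircuitFamily G) (x : List Bool) (S : Set (List Bool)) :
    (E.mapFamily F).kernelProb A x S = F.kernelProb A x S := by
  rw [QCircuitFamily.kernelProb, QCircuitFamily.kernelProb, kernel_mapFamily]

/-! ### The description transducer -/

/-- **The recoding of one gate code**: the empty string and oracle codes (tag bit `1`) are kept; a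
symbol code `0 ⟨numeral, wires⟩` becomes `0 ⟨κ numeral, wires⟩`.
[cite: AroraBarak2009, §6.2 (descriptions of circuits)] -/
def gateCodeFn (κ : List Bool → List Bool) : List Bool → List Bool :=
  iteFn isNilFn (fun _ => []) (iteFn HashBricks.headBitFn id (List.cons false ∘ fanoutFn (κ ∘ fstF) sndF ∘ List.tail))

/-- `gateCodeFn` on a symbol code. [folklore] -/
theorem gateCodeFn_cons_false (κ : List Bool → List Bool) (rest : List Bool) :
    gateCodeFn κ (false :: rest) = false :: boolPair (κ (fstF rest)) (sndF rest) := by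
  rw [gateCodeFn, iteFn_apply (b := false) (by simp [isNilFn]), if_neg Bool.false_ne_true,
    iteFn_apply (b := false) (HashBricks.headBitFn_apply _), if_neg Bool.false_ne_true]
  simp

/-- `gateCodeFn` on an oracle code. [folklore] -/
theorem gateCodeFn_cons_true (κ : List Bool → List Bool) (rest : List Bool) :
    gateCodeFn κ (true :: rest) = true :: rest := by
  rw [gateCodeFn, iteFn_apply (b := false) (by simp [isNilFn]), if_neg Bool.false_ne_true,
    iteFn_apply (b := true) (HashBricks.headBitFn_apply _), if_pos rfl, id]

/-- `gateCodeFn` on the empty string. [folklore] -/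
theorem gateCodeFn_nil (κ : List Bool → List Bool) : gateCodeFn κ [] = [] := by
  rw [gateCodeFn, iteFn_apply (b := true) (by simp [isNilFn]), if_pos rfl]

/-- `gateCodeFn κ ∈ FP` for `κ ∈ FP`. [cite: AroraBarak2009, §1.3] -/
theorem gateCodeFn_mem_FP {κ : List Bool → List Bool} (hκ : κ ∈ FP) : gateCodeFn κ ∈ FP :=
  iteFn_mem_FP isNilFn_mem_FP (const_mem_FP _)
    (iteFn_mem_FP HashBricks.headBitFn_mem_FP (PolyTimeComputable.id _)
      (comp_mem_FP (cons_mem_FP false) (comp_mem_FP (fanoutFn_mem_FP (comp_mem_FP hκ fstF_mem_FP) sndF_mem_FP)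
        PRelSigma.tail_mem_FP)))

/-- **Growth of `gateCodeFn`**: `|gateCodeFn κ a| ≤ |a| + 2s + 2` when `|κ m| ≤ |m| + s`. [folklore] -/
theorem length_gateCodeFn_le {κ : List Bool → List Bool} {s : ℕ} (hκ : ∀ m, (κ m).length ≤ m.length + s) (a : List Bool) :
    (gateCodeFn κ a).length ≤ a.length + (2 * s + 2) := by
  rcases a with _ | ⟨b, rest⟩
  · rw [gateCodeFn_nil]; simp
  · cases b
    · rw [gateCodeFn_cons_false, List.length_cons, length_boolPair, List.length_cons]
      have h1 := length_fstF_sndF_le rest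
      have h2 := hκ (fstF rest)
      omega
    · rw [gateCodeFn_cons_true]; omega

/-- **The code of a transported gate is the recoded code.** [cite: AroraBarak2009, §6.2 (descriptions of circuits)] -/
theorem encode_mapGate (g : QGate G n) : (E.mapGate g).encode = gateCodeFn E.codeFn g.encode := by
  cases g with
  | gate g e =>
    rw [mapGate, QGate.encode, QGate.encode, gateCodeFn_cons_false, fstF_boolPair, sndF_boolPair, E.codeFn_encode,
      ofFn_castEmb]
  | oracle k e => rw [mapGate, QGate.encode, QGate.encode, gateCodeFn_cons_true]

/-- The record `⟨d, ⟨bin |d|, ⟨ε, d⟩⟩⟩` on which the list map runs (yardstick and list both `d`).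
[folklore] -/
def listMapInit : List Bool → List Bool :=
  fanoutFn id (fanoutFn lenBinF (fanoutFn (fun _ => []) id))

/-- `listMapInit ∈ FP`. [folklore] -/
theorem listMapInit_mem_FP : listMapInit ∈ FP :=
  fanoutFn_mem_FP (PolyTimeComputable.id _) (fanoutFn_mem_FP lenBinF_mem_FP (fanoutFn_mem_FP (const_mem_FP _) (PolyTimeComputable.id _)))

/-- `listMapInit d = ⟨d, ⟨bin |d|, ⟨ε, d⟩⟩⟩`. [folklore] -/
theorem listMapInit_apply (d : List Bool) :
    listMapInit d = boolPair d (boolPair (encodeNat d.length) (boolPair [] d)) := by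
  simp [listMapInit]

/-- **Mapping a string function over a coded list**: `encList [a₁,…,a_k] ↦ encList [f a₁,…,f a_k]`
(the brick `mapLF` clocked by the code itself). [cite: AroraBarak2009, §1.3 (bounded loops)] -/
def listMapFn (f : List Bool → List Bool) : List Bool → List Bool :=
  mapLF (f ∘ sndPow 1) ∘ listMapInit

/-- **Value of `listMapFn` on a coded list.** [folklore] -/
theorem listMapFn_encList (f : List Bool → List Bool) (L : List (List Bool)) :
    listMapFn f (encList L) = encList (L.map f) := by
  rw [listMapFn, Function.comp_apply, listMapInit_apply, mapLF_apply _ _ _ le_rfl L,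
    List.take_of_length_le (Com.length_le_length_encList L)]
  congr 1
  refine List.map_congr_left fun a _ => ?_
  simp [sndPow]

/-- `listMapFn f ∈ FP` for `f ∈ FP` of linear growth `|f a| ≤ |a| + c`. [cite: AroraBarak2009, §1.3 (bounded loops)] -/
theorem listMapFn_mem_FP {f : List Bool → List Bool} (hf : f ∈ FP) {c : ℕ} (hc : ∀ a, (f a).length ≤ a.length + c) :
    listMapFn f ∈ FP := by
  refine comp_mem_FP (mapLF_mem_FP (w := 1) (P := Polynomial.C c) (comp_mem_FP hf (sndPow_mem_FP 1)) (by norm_num) ?_)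
    listMapInit_mem_FP
  intro x p a
  have := hc a
  simpa [sndPow] using this

/-- **The description transducer**: keep the two header fields `bin n`, `1^m` and recode every gate
code of the third. [cite: AroraBarak2009, §6.2 (descriptions of circuits)] -/
def descMapFn (κ : List Bool → List Bool) : List Bool → List Bool :=
  fanoutFn fstF (fanoutFn (nthF 1) (listMapFn (gateCodeFn κ) ∘ sndPow 1))

/-- `descMapFn κ ∈ FP` for `κ ∈ FP` of linear growth. [cite: AroraBarak2009, §1.3] -/
theorem descMapFn_mem_FP {κ : List Bool → List Bool} (hκ : κ ∈ FP) {s : ℕ} (hs : ∀ m, (κ m).length ≤ m.length + s) :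
    descMapFn κ ∈ FP :=
  fanoutFn_mem_FP fstF_mem_FP (fanoutFn_mem_FP (nthF_mem_FP 1)
    (comp_mem_FP (listMapFn_mem_FP (gateCodeFn_mem_FP hκ) (length_gateCodeFn_le hs)) (sndPow_mem_FP 1)))

/-- **Value of the description transducer on a description.** [folklore] -/
theorem descMapFn_apply (κ : List Bool → List Bool) (a u : List Bool) (L : List (List Bool)) :
    descMapFn κ (boolPair a (boolPair u (encList L))) = boolPair a (boolPair u (encList (L.map (gateCodeFn κ)))) := by
  simp [descMapFn, sndPow, listMapFn_encList]

/-- **The code of a transported circuit.** [cite: AroraBarak2009, §6.2 (descriptions of circuits)] -/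
theorem encode_mapCircuit (C : QCircuit G n) :
    (E.mapCircuit C).encode = encList ((C.gates.map QGate.encode).map (gateCodeFn E.codeFn)) := by
  rw [QCircuit.encode_eq_encList, gates_mapCircuit, List.map_map, List.map_map]
  congr 1
  refine List.map_congr_left fun g _ => ?_
  exact E.encode_mapGate g

/-- **The description function of the transported family is the transduced description
function.** [cite: AroraBarak2009, §6.2 (descriptions of circuits)] -/
theorem descFn_mapFamily (F : QCircuitFamily G) : (E.mapFamily F).descFn = descMapFn E.codeFn ∘ F.descFn := by
  funext z
  rw [Function.comp_apply, QCircuitFamily.descFn_eq, QCircuitFamily.descFn_eq]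
  change boolPair (encodeNat z.length) (boolPair (unaryEncodeNat (F.ancillas z.length)) (E.mapCircuit (F.circ z.length)).encode) =
    descMapFn E.codeFn (boolPair (encodeNat z.length) (boolPair (unaryEncodeNat (F.ancillas z.length)) (F.circ z.length).encode))
  rw [QCircuit.encode_eq_encList (F.circ z.length), descMapFn_apply, encode_mapCircuit]

/-- **Transport preserves polynomial-time uniformity.** [cite: BernsteinVazirani1997, §8] [cite: AroraBarak2009, §6.2 and §1.3] -/
theorem isUniform_mapFamily {F : QCircuitFamily G} (h : F.IsUniform) : (E.mapFamily F).IsUniform := by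
  rw [QCircuitFamily.isUniform_iff_descFn_mem_FP] at h ⊢
  rw [descFn_mapFamily]
  exact comp_mem_FP (descMapFn_mem_FP E.codeFn_mem_FP E.length_codeFn_le) h

/-! ### Classes -/

/-- **`BQPWith G ε ⊆ BQPWith G' ε` along an embedding of gate sets.** [cite: BernsteinVazirani1997, §8] [cite: NielsenChuang2010, §4.5.3] -/
theorem BQPWith_subset (E : GateSetEmb G G') (ε : ℝ) : BQPWith G ε ⊆ BQPWith G' ε := by
  rintro L ⟨F, hF, hU, hL⟩
  refine ⟨E.mapFamily F, E.isOracleFree_mapFamily hF, E.isUniform_mapFamily hU, fun x => ?_⟩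
  rw [acceptProbOn_mapFamily]
  exact hL x

/-- **`BQPOver G ⊆ BQPOver G'` along an embedding of gate sets.** [cite: BernsteinVazirani1997, §8] [cite: NielsenChuang2010, §4.5.3] -/
theorem BQPOver_subset (E : GateSetEmb G G') : BQPOver G ⊆ BQPOver G' := E.BQPWith_subset _

end GateSetEmb

end Literature.Computability.Cryptography

end
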